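import Summits.NavierStokesRegularity.NavierStokesRegularity.Theses.PalasekTowerBreakdown
import Summits.NavierStokesRegularity.FluidComputer.PalasekTowerGermHostFreeRunAt
import Summits.NavierStokesRegularity.FluidComputer.PalasekTowerTameCarrierAt

/-!
# `EpisodeBaseT` (crux stmt-NavierStokesRegularity-20303, K1 at `TowerRates.tuned`) from ANY tuned strict-slot
# filler and ONE FREE Navier–Stokes run of the first tuned window from its profile, with margins — BY NAME

Cell `ns-blowup`, seat `ns-blowup-ecbridge-3` (g8; D-0074 GROUP C «BRIDGE SUPPORT», lineage `host_preparation`).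
Route `PalasekTowerBreakdown` after the RE-BASE (rev 19): `EpisodeBaseT := EpisodeBaseGAt TowerRates.tuned`.
Composition of the FREE-RUN DOOR AT ARBITRARY RATES (`Germ.LevelZeroDataAt.episodeBaseGAt_of_freeRun`,
`PalasekTowerGermHostFreeRunAt.lean`, this seat) with the tuned register numerics (`TowerRates.tuned_boxNumerics`).
LABEL: E–C typing (KERNEL: theorems only; `--supports` stmt-NavierStokesRegularity-20303). WHAT THIS IS NOT: not
Navier–Stokes evidence — no free run of the first tuned window meeting the letter is exhibited; `EpisodeBaseT`
appears only as the conclusion of conditionals; nothing about `RungG 1` or blow-up is asserted.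

* `palasekTowerBreakdown_episodeBaseT_of_levelZeroDataAt_freeRun` — ANY profile `U` in the strict slot at
  `tuned` (`Germ.LevelZeroDataAt TowerRates.tuned U ρ`) and ONE classical finite-energy solution `(v, q)` of the
  UNFORCED Navier–Stokes system (`ν = 1`) on the first tuned window `[1, τ₁(tuned)]` from `v 1 = U` such that,
  for some margin `η > 0`, `‖v‖ ≤ (5/3)Y₁ − η` on the window and at `τ₁(tuned)`, in `‖x‖ ≤ ρ`: speed
  `≥ Y₁ + η`, gradient `≥ A₁ + η`, an `N₁`-core loop of circulation `≥ N₁^{β−2} + η` (tuned numbers) ⟹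
  `EpisodeBaseT`;
* `palasekTowerBreakdown_episodeBaseT_of_tameCarrierAt_freeRun` — the same with the profile fixed to the tame
  carrier `Germ.tameCarrierAt TowerRates.tuned a λ`.

So at the re-based register the crux's first child (host preparation) AND the host's fading residual force are
out of the MODEL-facing letter: what is left is ONE FREE Cauchy problem of the first tuned window from a named
profile (the superposition door at `tuned` — an amplifier far from a tame carrier, `PalasekTowerTameCarrierAtRun`
— is the remaining port). References: S. Palasek, arXiv:2605.13827 §4 [cite: Palasek2026ElementaryModel, §4];
T. Tao, Anal. PDE 6 (2013) Thm. 5.4 [cite: Tao2011, Thm. 5.4 (ii)+(iv)].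
-/

noncomputable section

-- `Summit.<Summit>.<Problem>` is the tree's mandated summit-side namespace (CONVENTIONS §2); for this
-- single-conjunct summit the two coincide, so the duplicate is deliberate.
set_option linter.dupNamespace false

namespace Summit.NavierStokesRegularity.NavierStokesRegularity.Theorems

open Set Function MeasureTheory Metric
open scoped ENNReal ContDiff
open Summit.NavierStokesRegularity.NavierStokesRegularity.Theses
open Summit.NavierStokesRegularity.FluidComputer.PalasekTowerClayBridge
open Summit.NavierStokesRegularity.FluidComputer.PalasekTowerClayBridge.Germ
open Literature.Analysis.FluidPDE

/-- **`EpisodeBaseT` FROM ANY TUNED STRICT-SLOT FILLER AND ONE FREE RUN WITH MARGINS.** Let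
`h : Germ.LevelZeroDataAt TowerRates.tuned U ρ` and let `(v, q)` be a classical finite-energy solution of the
UNFORCED Navier–Stokes system at unit viscosity on `[1, Host.τfirstAt tuned]` with `v 1 = U` such that, for some
`η > 0`, `‖v t x‖ ≤ (5/3) Y₁ − η` on the window and at `Host.τfirstAt tuned`, in `‖x‖ ≤ ρ`: `Y₁ + η ≤ ‖v‖`,
`A₁ + η ≤ ‖Dv‖`, an `N₁`-core loop with circulation `≥ N₁^{β−2} + η` (tuned numbers). Then `EpisodeBaseT`.
[cite: Palasek2026ElementaryModel, §4] [cite: Tao2011, Thm. 5.4 (ii)+(iv)] -/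
theorem palasekTowerBreakdown_episodeBaseT_of_levelZeroDataAt_freeRun
    {U : EuclideanSpace ℝ (Fin 3) → EuclideanSpace ℝ (Fin 3)} {ρ : ℝ} (h : LevelZeroDataAt TowerRates.tuned U ρ)
    {v : ℝ → EuclideanSpace ℝ (Fin 3) → EuclideanSpace ℝ (Fin 3)} {q : ℝ → EuclideanSpace ℝ (Fin 3) → ℝ}
    (hv : IsClassicalNSSolutionOn (Icc 1 (Host.τfirstAt TowerRates.tuned)) 1 0 v q) (hv1 : v 1 = U)
    (hvE : ∃ C : ℝ≥0∞, C < ⊤ ∧ ∀ t ∈ Icc (1 : ℝ) (Host.τfirstAt TowerRates.tuned), ∫⁻ x, ‖v t x‖ₑ ^ 2 ≤ C)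
    {η : ℝ} (hη : 0 < η)
    (hcap : ∀ t ∈ Icc (1 : ℝ) (Host.τfirstAt TowerRates.tuned), ∀ x, ‖v t x‖ ≤ 5 / 3 * TowerRates.tuned.Y 1 - η)
    (hspeed : ∃ x, ‖x‖ ≤ ρ ∧ TowerRates.tuned.Y 1 + η ≤ ‖v (Host.τfirstAt TowerRates.tuned) x‖)
    (hstrain : ∃ x, ‖x‖ ≤ ρ ∧ TowerRates.tuned.A 1 + η ≤ ‖fderiv ℝ (v (Host.τfirstAt TowerRates.tuned)) x‖)
    (hcore : ∃ (x : EuclideanSpace ℝ (Fin 3)) (γ : ℝ → EuclideanSpace ℝ (Fin 3)),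
      ‖x‖ ≤ ρ ∧ ContDiff ℝ 1 γ ∧ γ 0 = γ 1 ∧
      (∀ s ∈ Icc (0 : ℝ) 1, γ s ∈ closedBall x (1 / TowerRates.tuned.N 1)) ∧
      (∀ s ∈ Icc (0 : ℝ) 1, ‖deriv γ s‖ ≤ 8 * Real.pi / TowerRates.tuned.N 1) ∧
      TowerRates.tuned.N 1 ^ (TowerRates.tuned.β - 2) + η ≤ circulation (v (Host.τfirstAt TowerRates.tuned)) γ) :
    PalasekTowerBreakdown.EpisodeBaseT := by
  unfold PalasekTowerBreakdown.EpisodeBaseT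
  exact h.episodeBaseGAt_of_freeRun TowerRates.tuned_boxNumerics hv hv1 hvE hη hcap hspeed hstrain hcore

/-- **`EpisodeBaseT` FROM ONE FREE RUN OF A TAME CARRIER AT `tuned` WITH MARGINS** (`Germ.tameCarrierAt
TowerRates.tuned a λ`, `0 < a ≤ 5/256 ∧ 5/N₀ ∧ strainConst/N₀`, `0 < λ ≤ 1`). [cite: Palasek2026ElementaryModel, §4] -/
theorem palasekTowerBreakdown_episodeBaseT_of_tameCarrierAt_freeRun {a lam : ℝ} (ha : 0 < a)
    (h5 : a ≤ 5 / 256) (h5N : a ≤ 5 / TowerRates.tuned.N 0) (hκ : a ≤ TinyBlob.strainConst / TowerRates.tuned.N 0)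
    (hlam : 0 < lam) (hlam1 : lam ≤ 1)
    {v : ℝ → EuclideanSpace ℝ (Fin 3) → EuclideanSpace ℝ (Fin 3)} {q : ℝ → EuclideanSpace ℝ (Fin 3) → ℝ}
    (hv : IsClassicalNSSolutionOn (Icc 1 (Host.τfirstAt TowerRates.tuned)) 1 0 v q)
    (hv1 : v 1 = tameCarrierAt TowerRates.tuned a lam)
    (hvE : ∃ C : ℝ≥0∞, C < ⊤ ∧ ∀ t ∈ Icc (1 : ℝ) (Host.τfirstAt TowerRates.tuned), ∫⁻ x, ‖v t x‖ₑ ^ 2 ≤ C)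
    {η : ℝ} (hη : 0 < η)
    (hcap : ∀ t ∈ Icc (1 : ℝ) (Host.τfirstAt TowerRates.tuned), ∀ x, ‖v t x‖ ≤ 5 / 3 * TowerRates.tuned.Y 1 - η)
    (hspeed : ∃ x, ‖x‖ ≤ 7 ∧ TowerRates.tuned.Y 1 + η ≤ ‖v (Host.τfirstAt TowerRates.tuned) x‖)
    (hstrain : ∃ x, ‖x‖ ≤ 7 ∧ TowerRates.tuned.A 1 + η ≤ ‖fderiv ℝ (v (Host.τfirstAt TowerRates.tuned)) x‖)
    (hcore : ∃ (x : EuclideanSpace ℝ (Fin 3)) (γ : ℝ → EuclideanSpace ℝ (Fin 3)),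
      ‖x‖ ≤ 7 ∧ ContDiff ℝ 1 γ ∧ γ 0 = γ 1 ∧
      (∀ s ∈ Icc (0 : ℝ) 1, γ s ∈ closedBall x (1 / TowerRates.tuned.N 1)) ∧
      (∀ s ∈ Icc (0 : ℝ) 1, ‖deriv γ s‖ ≤ 8 * Real.pi / TowerRates.tuned.N 1) ∧
      TowerRates.tuned.N 1 ^ (TowerRates.tuned.β - 2) + η ≤ circulation (v (Host.τfirstAt TowerRates.tuned)) γ) :
    PalasekTowerBreakdown.EpisodeBaseT :=
  palasekTowerBreakdown_episodeBaseT_of_levelZeroDataAt_freeRun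
    (levelZeroDataAt_tameCarrierAt (R := TowerRates.tuned) ha h5 h5N hκ hlam hlam1) hv hv1 hvE hη hcap hspeed
    hstrain hcore

end Summit.NavierStokesRegularity.NavierStokesRegularity.Theorems

end
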